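import Mathlib
import Literature.AlgebraicGeometry.Resolution.Lipman1969RationalSurfaceSingularities
import Literature.AlgebraicGeometry.Resolution.ExceptionalCurvesLocalizedResolution
import Literature.AlgebraicGeometry.Resolution.FundamentalLocus
import Literature.AlgebraicGeometry.Resolution.RationalSurfaceSingularitiesBasic
import Literature.AlgebraicGeometry.Resolution.RegularLocalRingsNormal
import Literature.AlgebraicGeometry.Resolution.AlterationsResolution
import Literature.AlgebraicGeometry.Morphisms.CechH1LocalToGlobal
import Literature.AlgebraicGeometry.Morphisms.CechH1Leray
import Literature.AlgebraicGeometry.Morphisms.CechH1AffineProofs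
import Literature.AlgebraicGeometry.Morphisms.SteinFactorizationProofs
import HarnessLib

/-!
# Leray in degree one along a proper birational morphism of regular surfaces, POINTWISE form
# (no appeal to Lipman (1.2)): `R¹ρ_*𝒪 = 0` stalkwise ⇒ `Ȟ¹(Y₁, 𝒪) = 0 ⇒ Ȟ¹(X, 𝒪) = 0`

Topic: `Literature/AlgebraicGeometry/Resolution`.  Row F79-L at universe `u` (OPTION Ⅱ of the F-79 «2-reg»
sub-cell of the D-0154 (2) RES inputs cell; planner skeleton `F79_2reg_BRICKS_SKELETON.lean`, `stub_leray`, whose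
statement is proved byte-verbatim in the sequel `CechH1LerayRegularBirational.lean`), part 1 of 2.  This is the
universe-polymorphic Literature port of the W4.4 support programme «P_G LERAY» (Summits-side, universe `0`:
`…Theorems.HomologicalConductorSurfaceTerminationGenusLocalResolution` / `…GenusDomination` /
`…GenusTwoRegularLeray`, namespace `…GenusDescent`), with the named fact `Lipman1969_1_2` replaced by a
POINTWISE hypothesis; decl names here differ from the Summits-side ones on purpose (no ambiguity for files
opening both namespaces).

* `IsBirational.isIso_of_ringKrullDim_le_one` — a proper birational morphism from an integral scheme onto
  `Spec R`, `R` a normal Noetherian local domain of dimension `≤ 1`, is an isomorphism (tree `FundamentalLocus`);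
* `IsResolution.hasTrivialCechH1_pullback_snd_fromSpecStalk` — (L1) for a resolution `ρ : Z → X` and a REGULAR
  point `x` with `dim 𝒪_{X,x} ≤ 2`: `Ȟ¹ = 0` on `Z ×_X Spec 𝒪_{X,x}`, the dimension-two case being a
  HYPOTHESIS (for `dim ≤ 1` the base change is an isomorphism, hence affine: Görtz–Wedhorn II 22.1);
* `cechZ1_le_cechB1_chart_of_forall_hasTrivialCechH1` — (L2) chartwise `R¹ρ_*𝒪_Z = 0` over an affine open
  `U ⊆ X` from the pointwise vanishing at the points of `U` (transport to the chart, local-to-global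
  criterion `CechLocalization.cechZ1_le_cechB1_of_forall_isLocalization`, base change to `Spec 𝒪_{X,x}`);
* `IsBirational.isIso_app_of_isRegular` — `ρ_*𝒪_Z = 𝒪_X` for `ρ` proper birational onto a regular
  (normal) integral `X` (Stacks 0AY8, tree `TowardsNormal.isIso_app`);
* `cechRefineH1_comp_cechComapH1_surjective_of_forall_hasTrivialCechH1` — (L3)
  `Ȟ¹(𝒰, 𝒪_X) → Ȟ¹(ρ⁻¹𝒰, 𝒪_Z) → Ȟ¹(𝒲, 𝒪_Z)` is surjective (Görtz–Wedhorn II Cor. 21.82, degree one);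
* the gluing (L4) and the skeleton's `stub_leray` (L) are in the sequel
  `Resolution/CechH1LerayRegularBirational.lean`.

No definitions, no named facts; (1.2) `Lipman1969_1_2` stays PRINT; nothing about it is proved here.

## References
* A. Grothendieck, EGA III₁ (1961), Prop. (1.4.15). [EGAIII1]
* U. Görtz, T. Wedhorn, *Algebraic Geometry II* (2023), Lemma 22.1, Cor. 21.82. [GortzWedhorn2023]
* R. Hartshorne, *Algebraic Geometry* (1977), III Thm. 4.5. [Hartshorne1977]
* The Stacks Project, Tag 0AY8 (More on Morphisms, Lemma 37.53.6), Tag 01ED. [StacksProject]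
* O. Piltant, RACSAM 107 (2013), §2. [Piltant2013]  ·  M. Temkin, Adv. Math. 219 (2008), §2.1. [Temkin2008]
-/

noncomputable section

open CategoryTheory CategoryTheory.Limits AlgebraicGeometry TopologicalSpace IsLocalRing
open Literature.AlgebraicGeometry.Morphisms Literature.AlgebraicGeometry.Morphisms.CechLocalization

universe u

namespace Literature.AlgebraicGeometry.Resolution

/-! ## (L1) pointwise vanishing at a regular point of dimension `≤ 2` -/

section Pointwise

/-- The local rings of `Spec R`, `R` a normal domain, are integrally closed (they are the localisations
`R_𝔭`). [folklore] -/
private theorem isIntegrallyClosed_stalk_Spec' (R : Type u) [CommRing R] [IsDomain R]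
    [IsIntegrallyClosed R] (y : Spec (.of R)) : IsIntegrallyClosed ((Spec (.of R)).presheaf.stalk y) := by
  letI : Algebra R ((Spec (.of R)).presheaf.stalk y) :=
    inferInstanceAs (Algebra R ((Spec.structureSheaf R).presheaf.stalk y))
  haveI : IsLocalization.AtPrime ((Spec (.of R)).presheaf.stalk y) y.asIdeal :=
    StructureSheaf.IsLocalization.to_stalk R y
  exact isIntegrallyClosed_of_isLocalization _ y.asIdeal.primeCompl
    (Ideal.primeCompl_le_nonZeroDivisors _)

/-- **A proper birational morphism from an integral scheme onto the spectrum of a Noetherian normal LOCAL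
domain of dimension `≤ 1` (a field or a DVR) is an isomorphism** (tree `FundamentalLocus`: an isomorphism
over a neighbourhood of the closed point, which is everything). [cite: Piltant2013, §2, remark after Axiom 2] -/
theorem IsBirational.isIso_of_ringKrullDim_le_one (R : Type u) [CommRing R] [IsDomain R]
    [IsNoetherianRing R] [IsLocalRing R] [IsIntegrallyClosed R]
    {W : Scheme.{u}} [IsIntegral W] {g : W ⟶ Spec (.of R)} [IsProper g] (hg : IsBirational g)
    (hdim : ringKrullDim R ≤ 1) : IsIso g := by
  haveI : IsIntegral (Spec (.of R)) := inferInstance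
  -- the stalk at the closed point is `R` itself
  have hdim' : ringKrullDim ((Spec (.of R)).presheaf.stalk (closedPoint R)) ≤ 1 := by
    letI : Algebra R ((Spec (.of R)).presheaf.stalk (closedPoint R)) :=
      StructureSheaf.stalkAlgebra R (closedPoint R)
    haveI : IsLocalization.AtPrime ((Spec (.of R)).presheaf.stalk (closedPoint R))
        (maximalIdeal R) := StructureSheaf.IsLocalization.to_stalk R (closedPoint R)
    have e : R ≃+* (Spec (.of R)).presheaf.stalk (closedPoint R) :=
      (IsLocalization.atUnits R (maximalIdeal R).primeCompl (fun s hs => by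
        by_contra h
        exact hs ((IsLocalRing.mem_maximalIdeal _).mpr (mem_nonunits_iff.mpr h)))).toRingEquiv
    rwa [← ringKrullDim_eq_of_ringEquiv e]
  obtain ⟨V, hV, hiso⟩ := exists_isIso_morphismRestrict_of_ringKrullDim_le_one g hg ⊤
    (fun y _ => isIntegrallyClosed_stalk_Spec' R y) (Set.mem_univ _) hdim'
  -- an open of the local scheme containing the closed point is everything
  have hV' : V = ⊤ := (IsLocalRing.closedPoint_mem_iff V).mp hV
  subst hV'
  haveI := hiso
  have h2 : (g ⁻¹ᵁ (⊤ : (Spec (.of R)).Opens)).ι ≫ g = (g ∣_ ⊤) ≫ (⊤ : (Spec (.of R)).Opens).ι :=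
    (morphismRestrict_ι g ⊤).symm
  haveI : IsIso (⊤ : (Spec (.of R)).Opens).ι := by
    rw [← Scheme.topIso_hom]; infer_instance
  haveI : IsIso (g ⁻¹ᵁ (⊤ : (Spec (.of R)).Opens)).ι := by
    rw [show g ⁻¹ᵁ (⊤ : (Spec (.of R)).Opens) = ⊤ from rfl, ← Scheme.topIso_hom]; infer_instance
  haveI : IsIso ((g ⁻¹ᵁ (⊤ : (Spec (.of R)).Opens)).ι ≫ g) := by rw [h2]; infer_instance
  exact IsIso.of_isIso_comp_left (g ⁻¹ᵁ (⊤ : (Spec (.of R)).Opens)).ι g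

variable {X Z : Scheme.{u}} [IsIntegral X] [NoetherianSpace X] [NoetherianSpace Z]

set_option maxHeartbeats 400000 in
/-- **(L1) `Ȟ¹ = 0` on the base change of a resolution `ρ : Z → X` to `Spec 𝒪_{X,x}` at a REGULAR point `x`
of dimension `≤ 2`, the dimension-two case being a HYPOTHESIS `hpt2`**: for `dim 𝒪_{X,x} ≤ 1` the base change
(a resolution of `Spec 𝒪_{X,x}` with integral source, `IsResolution.pullback_snd_fromSpecStalk`) is an
isomorphism onto `Spec 𝒪_{X,x}` (`IsBirational.isIso_of_ringKrullDim_le_one`), hence affine, and Čech `H¹`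
of an affine scheme vanishes (`cechH1_affine_vanishing_holds`). [cite: Temkin2008, §2.1 (p. 6)]
[cite: GortzWedhorn2023, Lemma 22.1] -/
theorem IsResolution.hasTrivialCechH1_pullback_snd_fromSpecStalk {ρ : Z ⟶ X} (hρ : IsResolution ρ)
    (x : X) (hx : IsRegularLocalRing (X.presheaf.stalk x)) (hdim : ringKrullDim (X.presheaf.stalk x) ≤ 2)
    (hpt2 : ringKrullDim (X.presheaf.stalk x) = 2 →
      HasTrivialCechH1 (pullback.snd ρ (X.fromSpecStalk x))) :
    HasTrivialCechH1 (pullback.snd ρ (X.fromSpecStalk x)) := by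
  haveI := hρ.isProper
  have hres : IsResolution (pullback.snd ρ (X.fromSpecStalk x)) := hρ.pullback_snd_fromSpecStalk x
  -- integral source: irreducible (birational onto the irreducible `Spec 𝒪_{X,x}`) and reduced (regular)
  haveI : IrreducibleSpace ↥(pullback ρ (X.fromSpecStalk x)) := hres.isBirational.irreducibleSpace
  haveI : IsReduced (pullback ρ (X.fromSpecStalk x)) := hres.isRegular.isReduced
  haveI hint : IsIntegral (pullback ρ (X.fromSpecStalk x)) := isIntegral_of_irreducibleSpace_of_isReduced _
  haveI := hx
  haveI : IsIntegrallyClosed (X.presheaf.stalk x) := isIntegrallyClosed_of_isRegularLocalRing _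
  by_cases h2 : ringKrullDim (X.presheaf.stalk x) = 2
  · exact hpt2 h2
  · -- dimension `≤ 1`: the base change is an isomorphism, hence affine
    have h1 : ringKrullDim (X.presheaf.stalk x) ≤ 1 := by
      have hb := ringKrullDim_ne_bot (R := X.presheaf.stalk x)
      have ht := ringKrullDim_ne_top (R := X.presheaf.stalk x)
      obtain ⟨m, hm⟩ := WithBot.ne_bot_iff_exists.mp hb
      rw [← hm] at hdim h2 ht ⊢
      have hmt : m ≠ ⊤ := fun h => ht (by rw [h]; rfl)
      obtain ⟨n, hn⟩ := ENat.ne_top_iff_exists.mp hmt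
      rw [← hn] at hdim h2 ⊢
      have hle' : (n : ℕ∞) ≤ 2 := by
        rw [show (2 : WithBot ℕ∞) = ((2 : ℕ∞) : WithBot ℕ∞) from rfl] at hdim
        exact WithBot.coe_le_coe.mp hdim
      have hle : n ≤ 2 := by
        rw [show (2 : ℕ∞) = ((2 : ℕ) : ℕ∞) from rfl] at hle'
        exact ENat.coe_le_coe.mp hle'
      have hne : n ≠ 2 := fun h => h2 (by rw [h]; rfl)
      have h1' : (n : ℕ∞) ≤ 1 := by
        rw [show (1 : ℕ∞) = ((1 : ℕ) : ℕ∞) from rfl]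
        exact ENat.coe_le_coe.mpr (by omega)
      rw [show (1 : WithBot ℕ∞) = ((1 : ℕ∞) : WithBot ℕ∞) from rfl]
      exact WithBot.coe_le_coe.mpr h1'
    haveI := hres.isProper
    haveI := IsBirational.isIso_of_ringKrullDim_le_one (X.presheaf.stalk x) hres.isBirational h1
    haveI : IsAffine (pullback ρ (X.fromSpecStalk x)) :=
      IsAffine.of_isIso (pullback.snd ρ (X.fromSpecStalk x))
    intro ι _ U hU hcov
    refine ⟨fun a b => ?_⟩
    obtain ⟨za, rfl⟩ := CechH1.mk_surjective _ U a
    obtain ⟨zb, rfl⟩ := CechH1.mk_surjective _ U b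
    have hv := cechH1_affine_vanishing_holds (pullback.snd ρ (X.fromSpecStalk x))
      (isAffineOpen_top _) U hcov
    rw [(CechH1.mk_eq_zero_iff _ U za).mpr (hv za.2), (CechH1.mk_eq_zero_iff _ U zb).mpr (hv zb.2)]

end Pointwise

/-! ## (L2) chartwise `R¹ρ_*𝒪_Z = 0` from pointwise vanishing -/

section Chart

variable {T : Type u} [CommRing T] {X Z : Scheme.{u}} (πX : X ⟶ Spec (.of T)) (ρ : Z ⟶ X)

/-- **(L2) chartwise `R¹ρ_*𝒪_Z = 0`, pointwise form**: for `ρ : Z → X` over `πX : X → Spec T`, an affine open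
`U ⊆ X` such that `Ȟ¹ = 0` on `Z ×_X Spec 𝒪_{X,x} → Spec 𝒪_{X,x}` for every `x ∈ U`, and a finite family `𝒢` of
affine opens of `Z` with `⋃ 𝒢 = ρ⁻¹U` and affine pairwise and triple intersections: `Ȟ¹(𝒢, 𝒪_Z) = 0`
(transport to the chart `ρ⁻¹U`, local-to-global criterion over `Γ(X, U)`, base change to `Spec 𝒪_{X,x}` at
each maximal ideal). [cite: EGAIII1, Prop. (1.4.15)] -/
theorem cechZ1_le_cechB1_chart_of_forall_hasTrivialCechH1 {U : X.Opens}
    (hpt : ∀ x ∈ U, HasTrivialCechH1 (pullback.snd ρ (X.fromSpecStalk x)))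
    (hU : IsAffineOpen U) {κ : Type u} [Finite κ] (G : κ → Z.Opens) (hGcov : ⨆ j, G j = ρ ⁻¹ᵁ U)
    (hG : ∀ j, IsAffineOpen (G j)) (hG2 : ∀ j j', IsAffineOpen (G j ⊓ G j'))
    (hG3 : ∀ j j' j'', IsAffineOpen (G j ⊓ G j' ⊓ G j'')) :
    cechZ1 (ρ ≫ πX) G ≤ cechB1 (ρ ≫ πX) G := by
  classical
  have hGle : ∀ j, G j ≤ ρ ⁻¹ᵁ U := fun j => hGcov ▸ le_iSup G j
  -- (A) transport to the chart `ρ⁻¹U` along the open immersion `ι = (ρ⁻¹U).ι`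
  have hbij : ∀ V : Z.Opens, V ≤ ρ ⁻¹ᵁ U →
      Function.Bijective (Sections.comap (ρ ≫ πX) ((ρ ⁻¹ᵁ U).ι ≫ ρ ≫ πX) (ρ ⁻¹ᵁ U).ι rfl
        (le_refl ((ρ ⁻¹ᵁ U).ι ⁻¹ᵁ V))) := by
    intro V hV
    have hVr : V ≤ (ρ ⁻¹ᵁ U).ι.opensRange := by rwa [Scheme.Opens.opensRange_ι]
    haveI := (ρ ⁻¹ᵁ U).ι.isIso_app V hVr
    rw [show (Sections.comap (ρ ≫ πX) ((ρ ⁻¹ᵁ U).ι ≫ ρ ≫ πX) (ρ ⁻¹ᵁ U).ι rfl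
        (le_refl ((ρ ⁻¹ᵁ U).ι ⁻¹ᵁ V)) : _ → _) = ((ρ ⁻¹ᵁ U).ι.app V).hom from by
      funext s; rw [Sections.comap_apply, Scheme.Hom.appLE_eq_app]]
    exact ConcreteCategory.bijective_of_isIso ((ρ ⁻¹ᵁ U).ι.app V)
  refine cechZ1_le_cechB1_of_comap_bijective (ρ ≫ πX) ((ρ ⁻¹ᵁ U).ι ≫ ρ ≫ πX) (ρ ⁻¹ᵁ U).ι rfl G
    (fun j => (hbij (G j) (hGle j)).2)
    (fun j j' => (hbij (G j ⊓ G j') (inf_le_left.trans (hGle j))).1) ?_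
  -- (B) regard the chart as a `Γ(X, U)`-scheme via `ρ ∣_ U`
  rw [cechZ1_le_cechB1_irrel_base ((ρ ⁻¹ᵁ U).ι ≫ ρ ≫ πX) ((ρ ∣_ U) ≫ hU.isoSpec.hom)]
  have haffι : ∀ V : Z.Opens, V ≤ ρ ⁻¹ᵁ U → IsAffineOpen V →
      IsAffineOpen ((ρ ⁻¹ᵁ U).ι ⁻¹ᵁ V) := by
    intro V hV hVa
    rw [← (ρ ⁻¹ᵁ U).ι.isAffineOpen_iff_of_isOpenImmersion,
      Scheme.Hom.image_preimage_eq_opensRange_inf, Scheme.Opens.opensRange_ι, inf_eq_right.mpr hV]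
    exact hVa
  have hG' : ∀ j, IsAffineOpen (preimageFamily (ρ ⁻¹ᵁ U).ι G j) := fun j =>
    haffι (G j) (hGle j) (hG j)
  have hG2' : ∀ j j', IsAffineOpen (preimageFamily (ρ ⁻¹ᵁ U).ι G j ⊓
      preimageFamily (ρ ⁻¹ᵁ U).ι G j') := fun j j' =>
    haffι (G j ⊓ G j') (inf_le_left.trans (hGle j)) (hG2 j j')
  have hG3' : ∀ j j' j'', IsAffineOpen (preimageFamily (ρ ⁻¹ᵁ U).ι G j ⊓
      preimageFamily (ρ ⁻¹ᵁ U).ι G j' ⊓ preimageFamily (ρ ⁻¹ᵁ U).ι G j'') := fun j j' j'' =>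
    haffι (G j ⊓ G j' ⊓ G j'') ((inf_le_left.trans inf_le_left).trans (hGle j)) (hG3 j j' j'')
  refine cechZ1_le_cechB1_of_forall_isLocalization ((ρ ∣_ U) ≫ hU.isoSpec.hom)
    (preimageFamily (ρ ⁻¹ᵁ U).ι G) hG' hG2' hG3' ?_
  -- (C) at a maximal ideal `𝔪 ↔ x ∈ U`: base change to `Spec 𝒪_{X,x}` and pointwise vanishing
  intro 𝔪 h𝔪
  let y : PrimeSpectrum Γ(X, U) := ⟨𝔪, h𝔪.isPrime⟩
  have hx : hU.fromSpec.base y ∈ U := by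
    have h : hU.fromSpec.base y ∈ hU.fromSpec.opensRange := ⟨y, rfl⟩
    rwa [hU.opensRange_fromSpec] at h
  letI alg : Algebra Γ(X, U) (X.presheaf.stalk (hU.fromSpec.base y)) :=
    TopCat.Presheaf.algebra_section_stalk X.presheaf ⟨hU.fromSpec.base y, hx⟩
  have hloc : IsLocalization.AtPrime (X.presheaf.stalk (hU.fromSpec.base y)) y.asIdeal :=
    hU.isLocalization_stalk' y hx
  have hgerm : CommRingCat.ofHom (algebraMap Γ(X, U) (X.presheaf.stalk (hU.fromSpec.base y))) =
      X.presheaf.germ U (hU.fromSpec.base y) hx := rfl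
  -- right square: the chart over `Spec Γ(X, U) ≅ U ⊆ X`
  have t : IsPullback (ρ ⁻¹ᵁ U).ι ((ρ ∣_ U) ≫ hU.isoSpec.hom) ρ (hU.isoSpec.inv ≫ U.ι) :=
    (isPullback_morphismRestrict ρ U).flip.of_iso (Iso.refl _) (Iso.refl _) hU.isoSpec (Iso.refl _)
      (by simp) (by simp) (by simp) (by simp)
  -- outer square: Mathlib's base change to `Spec 𝒪_{X,x}`
  have hφ : X.fromSpecStalk (hU.fromSpec.base y) =
      Spec.map (CommRingCat.ofHom (algebraMap Γ(X, U) (X.presheaf.stalk (hU.fromSpec.base y)))) ≫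
        (hU.isoSpec.inv ≫ U.ι) := by
    rw [hgerm, hU.isoSpec_inv_ι, ← hU.fromSpecStalk_eq_fromSpecStalk hx]; rfl
  have s : IsPullback (pullback.fst ρ (X.fromSpecStalk (hU.fromSpec.base y)))
      (pullback.snd ρ (X.fromSpecStalk (hU.fromSpec.base y))) ρ
      (Spec.map (CommRingCat.ofHom (algebraMap Γ(X, U) (X.presheaf.stalk (hU.fromSpec.base y)))) ≫
        (hU.isoSpec.inv ≫ U.ι)) :=
    (IsPullback.of_hasPullback ρ (X.fromSpecStalk (hU.fromSpec.base y))).of_iso (Iso.refl _)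
      (Iso.refl _) (Iso.refl _) (Iso.refl _) (by simp only [Iso.refl_hom, Category.comp_id,
        Category.id_comp]) (by simp only [Iso.refl_hom, Category.comp_id, Category.id_comp])
      (by simp only [Iso.refl_hom, Category.comp_id, Category.id_comp])
      (by simp only [Iso.refl_hom, Category.comp_id, Category.id_comp]; exact hφ)
  have H := IsPullback.of_right' s t
  refine ⟨X.presheaf.stalk (hU.fromSpec.base y), inferInstance, alg, hloc,
    pullback ρ (X.fromSpecStalk (hU.fromSpec.base y)),
    pullback.snd ρ (X.fromSpecStalk (hU.fromSpec.base y)), _, H, ?_⟩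
  -- pointwise vanishing (`hpt`) in the `𝒪_{X,x}`-structure
  rw [cechZ1_le_cechB1_irrel_base _ (pullback.snd ρ (X.fromSpecStalk (hU.fromSpec.base y)))]
  apply cechZ1_le_cechB1_of_subsingleton_cechH1
  have htriv := hpt (hU.fromSpec.base y) hx
  haveI : IsAffineHom (t.lift (pullback.fst ρ (X.fromSpecStalk (hU.fromSpec.base y)))
      (pullback.snd ρ (X.fromSpecStalk (hU.fromSpec.base y)) ≫
        Spec.map (CommRingCat.ofHom (algebraMap Γ(X, U) (X.presheaf.stalk (hU.fromSpec.base y)))))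
      (by rw [s.w, Category.assoc])) :=
    isAffineHom_isStableUnderBaseChange.of_isPullback H.flip inferInstance
  refine htriv κ _ (fun j => (hG' j).preimage _) ?_
  change ⨆ j, _ ⁻¹ᵁ ((ρ ⁻¹ᵁ U).ι ⁻¹ᵁ G j) = ⊤
  rw [← Scheme.Hom.preimage_iSup, ← Scheme.Hom.preimage_iSup, hGcov, Scheme.Opens.ι_preimage_self]
  rfl

end Chart

/-! ## `ρ_*𝒪_Z = 𝒪_X` for a proper birational `ρ` onto a regular integral `X` -/

section Domination

variable {X Z : Scheme.{u}}

/-- A surjective morphism between irreducible schemes maps the generic point to the generic point.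
[folklore] -/
private theorem base_genericPoint_eq_of_surjective (ρ : Z ⟶ X) [IrreducibleSpace X]
    [IrreducibleSpace Z] [Surjective ρ] : ρ.base (genericPoint Z) = genericPoint X := by
  have h := (genericPoint_spec Z).image ρ.continuous
  rw [Set.image_univ_of_surjective ρ.surjective, closure_univ] at h
  exact h.eq (genericPoint_spec X)

/-- If `ρ` restricts to an isomorphism over the open `O ⊆ X`, its base change along any morphism factoring
through `O` is an isomorphism. [folklore] -/
private theorem isIso_pullback_snd_of_factor_through_isoLocus (ρ : Z ⟶ X) (O : X.Opens)
    [IsIso (ρ ∣_ O)]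
    {S : Scheme.{u}} (ψ : S ⟶ X) (g : S ⟶ O) (hψ : ψ = g ≫ O.ι) : IsIso (pullback.snd ρ ψ) := by
  subst hψ
  haveI : IsIso (pullback.snd ρ O.ι) := by
    rw [← pullbackRestrictIsoRestrict_hom_morphismRestrict]
    infer_instance
  haveI : IsIso ((pullbackLeftPullbackSndIso ρ O.ι g).hom ≫ pullback.snd ρ (g ≫ O.ι)) := by
    rw [pullbackLeftPullbackSndIso_hom_snd]
    infer_instance
  exact IsIso.of_isIso_comp_left (pullbackLeftPullbackSndIso ρ O.ι g).hom _

/-- **`ρ_*𝒪_Z = 𝒪_X`** for `ρ` proper surjective from an integral scheme, an isomorphism over a non-empty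
open of the normal integral scheme `X` (Stacks 0AY8, tree `TowardsNormal.isIso_app`): `𝒪_X(V) → 𝒪_Z(ρ⁻¹V)`
is an isomorphism for every open `V`. [cite: StacksProject, Tag 0AY8 (More on Morphisms, Lemma 37.53.6)] -/
theorem isIso_app_of_surjective_of_isIso_morphismRestrict (ρ : Z ⟶ X) [IsIntegral X] [IsIntegral Z]
    [IsProper ρ] [Surjective ρ] (hXn : ∀ x : X, IsIntegrallyClosed (X.presheaf.stalk x)) (O : X.Opens)
    (hO : (O : Set X).Nonempty) [IsIso (ρ ∣_ O)] (V : X.Opens) : IsIso (ρ.app V) := by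
  haveI : Nonempty O := by
    obtain ⟨y, hy⟩ := hO
    exact ⟨⟨y, hy⟩⟩
  have hξO : genericPoint X ∈ O := TowardsNormal.genericPoint_mem X O
  have hgen : ∀ z ∈ genericPoints Z, ρ.base z = genericPoint X := by
    intro z hz
    rw [genericPoints_eq_singleton, Set.mem_singleton_iff] at hz
    rw [hz]
    exact base_genericPoint_eq_of_surjective ρ
  have hrange : Set.range (X.fromSpecResidueField (genericPoint X)) ⊆ Set.range O.ι := by
    rw [Scheme.range_fromSpecResidueField, Scheme.Opens.range_ι, Set.singleton_subset_iff]
    exact hξO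
  haveI : IsIso (ρ.fiberToSpecResidueField (genericPoint X)) :=
    isIso_pullback_snd_of_factor_through_isoLocus ρ O (X.fromSpecResidueField (genericPoint X))
      (IsOpenImmersion.lift O.ι _ hrange) (IsOpenImmersion.lift_fac _ _ hrange).symm
  have hξ : IsIso (ρ.fiberToSpecResidueField (genericPoint X)).appTop :=
    (inferInstance : IsIso ((ρ.fiberToSpecResidueField (genericPoint X)).app ⊤))
  exact TowardsNormal.isIso_app ρ hXn hgen hξ V

/-- **`ρ_*𝒪_Z = 𝒪_X`** for `ρ : Z → X` proper birational between integral schemes with `X` regular (hence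
normal): `𝒪_X(V) → 𝒪_Z(ρ⁻¹V)` is an isomorphism for every open `V`.
[cite: StacksProject, Tag 0AY8 (More on Morphisms, Lemma 37.53.6)] -/
theorem IsBirational.isIso_app_of_isRegular [IsIntegral X] [IsIntegral Z] {ρ : Z ⟶ X} [IsProper ρ]
    (hρ : IsBirational ρ) (hX : Scheme.IsRegular X) (V : X.Opens) : IsIso (ρ.app V) := by
  haveI : IsDominant ρ := hρ.isDominant
  obtain ⟨O, hO, -, hiso⟩ := hρ
  haveI := hiso
  exact isIso_app_of_surjective_of_isIso_morphismRestrict ρ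
    (fun x => by haveI := hX x; exact isIntegrallyClosed_of_isRegularLocalRing _) O hO.nonempty V

variable {T : Type u} [CommRing T] (ρ : Z ⟶ X) (πX : X ⟶ Spec (.of T))

/-- With `ρ.app V` an isomorphism, the section pullback `𝒪_X(V) → 𝒪_Z(W)`, `W = ρ⁻¹V`, is bijective.
[folklore] -/
private theorem comap_bijective_of_isIso_app' {V : X.Opens} {W : Z.Opens} (e : W ≤ ρ ⁻¹ᵁ V)
    (heq : W = ρ ⁻¹ᵁ V) [IsIso (ρ.app V)] :
    Function.Bijective (Sections.comap πX (ρ ≫ πX) ρ rfl e) := by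
  subst heq
  rw [show (Sections.comap πX (ρ ≫ πX) ρ rfl e : _ → _) = (ρ.app V).hom from by
    funext s; rw [Sections.comap_apply, Scheme.Hom.appLE_eq_app]]
  exact ConcreteCategory.bijective_of_isIso (ρ.app V)

/-- **(L3) Leray in degree one along a domination, pointwise form: `Ȟ¹(𝒰, 𝒪_X) ↠ Ȟ¹(𝒲, 𝒪_Z)`** for
`ρ : Z → X` proper birational between integral schemes, `X` regular (so `ρ_*𝒪_Z = 𝒪_X`), `Ȟ¹ = 0` on
`Z ×_X Spec 𝒪_{X,x} → Spec 𝒪_{X,x}` for every `x`, a finite family `𝒰` of affine opens of `X` and a finite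
affine open cover `𝒲` of `Z` refining `ρ⁻¹𝒰` via `τ` (the opens `ρ⁻¹U_i ∩ W_j` and their pairwise and triple
intersections affine): the composite `Ȟ¹(𝒰, 𝒪_X) → Ȟ¹(ρ⁻¹𝒰, 𝒪_Z) → Ȟ¹(𝒲, 𝒪_Z)` is surjective.
[cite: GortzWedhorn2023, Cor. 21.82 (p. 265)] -/
theorem cechRefineH1_comp_cechComapH1_surjective_of_forall_hasTrivialCechH1 [IsIntegral X]
    [IsIntegral Z] [IsProper ρ] (hρ : IsBirational ρ) (hX : Scheme.IsRegular X)
    (hpt : ∀ x : X, HasTrivialCechH1 (pullback.snd ρ (X.fromSpecStalk x)))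
    {ι : Type u} [Finite ι] (U : ι → X.Opens) (hU : ∀ i, IsAffineOpen (U i))
    {κ : Type u} [Finite κ] (W : κ → Z.Opens) (hWcov : ⨆ j, W j = ⊤) (τ : κ → ι)
    (hτ : ∀ j, W j ≤ ρ ⁻¹ᵁ U (τ j)) (hUW : ∀ i j, IsAffineOpen (ρ ⁻¹ᵁ U i ⊓ W j))
    (hUW2 : ∀ i j j', IsAffineOpen (ρ ⁻¹ᵁ U i ⊓ W j ⊓ (ρ ⁻¹ᵁ U i ⊓ W j')))
    (hUW3 : ∀ i j j' j'',
      IsAffineOpen (ρ ⁻¹ᵁ U i ⊓ W j ⊓ (ρ ⁻¹ᵁ U i ⊓ W j') ⊓ (ρ ⁻¹ᵁ U i ⊓ W j''))) :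
    Function.Surjective
      (cechRefineH1 (ρ ≫ πX) (preimageFamily ρ U) W τ hτ ∘ₗ cechComapH1 πX (ρ ≫ πX) ρ rfl U) := by
  rw [LinearMap.coe_comp]
  refine Function.Surjective.comp ?_ ?_
  · refine cechRefineH1_surjective (ρ ≫ πX) (preimageFamily ρ U) W τ hτ (fun i => ?_) fun i => ?_
    · rw [hWcov]; exact le_top
    · exact cechZ1_le_cechB1_chart_of_forall_hasTrivialCechH1 πX ρ (fun x _ => hpt x) (hU i)
        (fun j => ρ ⁻¹ᵁ U i ⊓ W j) (by rw [← inf_iSup_eq, hWcov, inf_top_eq]) (hUW i) (hUW2 i)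
        (hUW3 i)
  · haveI := fun V : X.Opens => hρ.isIso_app_of_isRegular hX V
    exact cechComapH1_surjective_of_appLE_bijective πX (ρ ≫ πX) ρ rfl U
      (fun i i' => comap_bijective_of_isIso_app' ρ πX _ rfl)
      (fun i i' i'' => (comap_bijective_of_isIso_app' ρ πX _ rfl).1)

end Domination

end Literature.AlgebraicGeometry.Resolution

end
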